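/-
Copyright (c) 2026. All rights reserved.
Released under Apache 2.0 license as described in the file LICENSE.
Authors: abc-iut cell, seat abc-iut-L6-t6 (bridge for abc-iut-L6-t4's `GlobalFrobenioidModels.lean`,
MERGE-MAP §1 row «Ex 3.6 (i)/(ii) is a Frobenioid»).
-/
import Literature.IUT.LogThetaLattice.GlobalFrobenioidModelsData
import Literature.AlgebraicGeometry.Frobenioids.ModelFrobenioidIsFrobenioid
import Literature.AlgebraicGeometry.Frobenioids.FrobenioidEquivalence
import HarnessLib

/-!
# [IUTchIII] Example 3.6 (ii): `𝓕⊛_𝔪𝔬𝔡` "admits a natural Frobenioid structure" — verified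

S. Mochizuki, *Inter-universal Teichmüller Theory III*, kurims manuscript (May 2020), Example 3.6 (ii),
p. 108 l. 5–11 [claim key Mochizuki2012, status disputed (D-0012)]:

> "Thus, `𝓕⊛_𝔪𝔬𝔡` forms a category. In fact, one verifies immediately that, from the point of view of
> the theory of Frobenioids developed in [FrdI], [FrdII], `𝓕⊛_𝔪𝔬𝔡` admits a natural Frobenioid structure
> [cf. [FrdI], Definition 1.3], for which the base category is the category with precisely one
> arrow. Relative to this Frobenioid structure, the elementary morphisms are precisely the linear
> morphisms, and the positive integer '`n`' that appears in the definition of a morphism of `𝓕⊛_𝔪𝔬𝔡`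
> is the Frobenius degree of the morphism."

This proof-only file VERIFIES these four clauses in the cell's [FrdI] vocabulary (abc-iut-found's
Definition 1.3, `PreFrobenioid.IsFrobenioid`), for the category `FrakCat` of
`GlobalFrobenioidModelsCategory.lean` and the structure functor / comparison EQUIVALENCE
`toModel : 𝓕⊛_𝔪𝔬𝔡 ≌ ModelFrobenioid(𝒟, Φ, 𝔹, Div_𝔹)` of `GlobalFrobenioidModelsData.lean`:
* the data satisfy the hypotheses of [FrdI] Thm. 5.2 (ii): `Φ(∗)` is divisorial (`isDivisorial_effDiv`:
  integral, saturated, sharp from the cone hypotheses), `𝔹(∗) = F^×` is group-like, the constant monoids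
  are monoids on the one-arrow base (`isMonoidOn_constMonoidOn`);
* hence the structure `𝓕⊛_𝔪𝔬𝔡 → F_Φ` (`structureFunctor`) is a FROBENIOID (`isFrobenioid`) — by
  abc-iut-found's [FrdI] Thm. 5.2 (ii) `ModelFrobenioid.isFrobenioid` (model Frobenioids of a divisorial
  `Φ` and group-like `𝔹` over a connected totally epimorphic base are Frobenioids) transported along the
  equivalence (`PreFrobenioid.IsFrobenioid.comp_of_isEquivalence`, `FrobenioidEquivalence.lean`) — and of
  isotropic type;
* its base category is the one-arrow category (`baseObj_eq`), a morphism `(n, f)` has Frobenius degree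
  `n` (`degFr_eq_deg`), and it is linear iff `n = 1` iff it is an elementary morphism
  (`isLinear_iff_deg_eq_one`, with abc-iut-L6-t6's `FrakObj.isHom_one_iff`).
The hypotheses are those of `ModelHyps` on the abstract local value groups. The remaining printed clause
of (ii) — the isomorphism of Frobenioids `𝓕⊛_mod ⥲ 𝓕⊛_𝔪𝔬𝔡` with [IUTchI] Ex. 5.1 (iii)'s `𝓕⊛_mod` inducing
the identity on `F^×_mod` [cf. [FrdI] Cor. 4.10] — involves abc-iut-L5-t1's `GlobalFrobenioid.Fmod` and is
not treated here. Nothing here takes a side on [IUTchIII] Cor. 3.12; typed ≠ endorsed.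
-/

noncomputable section

namespace Literature.IUT.LogThetaLattice

namespace GlobalFrobenioidModels

open CategoryTheory Opposite Literature.AlgebraicGeometry.Frobenioids

universe u

variable {F : Type u} [Field F] {V : Type u} {Γ : V → Type u} [∀ v, AddCommGroup (Γ v)]
  {nonneg : ∀ v, AddSubmonoid (Γ v)} {β : ∀ v, Additive Fˣ →+ Γ v} (H : ModelHyps nonneg β)

/-! ### The hypotheses of [FrdI] Thm. 5.2 (ii) for the data `(𝒟, Φ, 𝔹, Div_𝔹)` -/

/-- A constant monoid on the one-morphism category is a monoid on it in the sense of [FrdI] Def. 1.1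
(ii) (all pull-back maps are identities). [cite: MochizukiFrdI2008, Def. 1.1(ii) p.19] -/
theorem isMonoidOn_constMonoidOn (M : Type u) [CommMonoid M] : IsMonoidOn (constMonoidOn M) where
  isCharInjective f := by
    refine ⟨fun x y h => h, fun x y hxy => ?_⟩
    obtain ⟨a, rfl⟩ := Associates.mk_surjective x
    obtain ⟨b, rfl⟩ := Associates.mk_surjective y
    rw [associatesMap_mk, associatesMap_mk] at hxy
    exact hxy
  bijective_of_isFSM f _ := ⟨fun x y h => h, fun y => ⟨y, rfl⟩⟩

include H in
/-- `Φ(∗)` is a divisorial monoid ([FrdI] Def. 1.1 (i)): integral and of characteristic type because it is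
cancellative, saturated because the cones `Γ_v^{≥0}` are, sharp because they are.
([IUTchIII] Ex 3.6 (ii) p.108) [claim: Mochizuki2012, status: disputed] -/
theorem isDivisorial_effDiv : IsDivisorial (EffDiv V Γ nonneg) where
  isPreDivisorial :=
    { isIntegral := ⟨Algebra.GrothendieckGroup.of_injective⟩
      isSaturated := ⟨fun x n hn hx => by
        obtain ⟨y, rfl⟩ := toGp_surjective H x
        obtain ⟨c, hc⟩ := hx
        -- `x ^ n = of c`: the family `n • D` is effective, hence so is `D`
        set D := Multiplicative.toAdd y with hD
        have hy : y = Multiplicative.ofAdd D := rfl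
        have h1 : toGp H (Multiplicative.ofAdd (n • D)) =
            toGp H (Multiplicative.ofAdd ((Multiplicative.toAdd c : effDiv V Γ nonneg) : FrakObj V Γ)) := by
          rw [ofAdd_nsmul, map_pow, ← hy, ← hc, toGp_ofAdd, toGpFun_of_mem H (Multiplicative.toAdd c).2]
          rfl
        have h2 : n • D = ((Multiplicative.toAdd c : effDiv V Γ nonneg) : FrakObj V Γ) :=
          Multiplicative.ofAdd.injective (toGp_injective H h1)
        have hDmem : D ∈ effDiv V Γ nonneg := fun v =>
          H.saturated v (D.cls v) n hn (by
            rw [← FrakObj.cls_nsmul, h2]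
            exact (Multiplicative.toAdd c).2 v)
        exact ⟨Multiplicative.ofAdd ⟨D, hDmem⟩, by rw [hy, toGp_ofAdd, toGpFun_of_mem H hDmem]⟩⟩
      isOfCharType := ⟨fun u a h => Units.ext (mul_right_cancel (h.trans (one_mul a).symm))⟩ }
  isSharp := ⟨fun a ha => by
    obtain ⟨b, hb⟩ := ha.exists_right_inv
    have hab : (Multiplicative.toAdd a : effDiv V Γ nonneg) + Multiplicative.toAdd b = 0 :=
      congrArg Multiplicative.toAdd hb
    have key : (Multiplicative.toAdd a : effDiv V Γ nonneg) = 0 := by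
      apply Subtype.ext
      refine FrakObj.ext_cls (funext fun v => ?_)
      have hv : ((Multiplicative.toAdd a : effDiv V Γ nonneg) : FrakObj V Γ).cls v +
          ((Multiplicative.toAdd b : effDiv V Γ nonneg) : FrakObj V Γ).cls v = 0 :=
        congrArg (fun D : effDiv V Γ nonneg => (D : FrakObj V Γ).cls v) hab
      refine H.sharp v _ ((Multiplicative.toAdd a).2 v) ?_
      rw [show -((Multiplicative.toAdd a : effDiv V Γ nonneg) : FrakObj V Γ).cls v =
        ((Multiplicative.toAdd b : effDiv V Γ nonneg) : FrakObj V Γ).cls v from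
          (neg_eq_of_add_eq_zero_right hv)]
      exact (Multiplicative.toAdd b).2 v
    exact (congrArg Multiplicative.ofAdd key : _)⟩

/-- A commutative group is group-like as a monoid ([FrdI] Def. 1.1 (i)); here for `𝔹(∗) = F^×_mod`.
([IUTchIII] Ex 3.6 (ii) p.108) [claim: Mochizuki2012, status: disputed] -/
theorem isGroupLike_units : IsGroupLike Fˣ where
  isPreDivisorial :=
    { isIntegral := ⟨Algebra.GrothendieckGroup.of_injective⟩
      isSaturated := ⟨fun x _ _ _ => by
        obtain ⟨⟨a, b⟩, h⟩ := (Localization.monoidOf (⊤ : Submonoid Fˣ)).surj x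
        exact ⟨a * (b : Fˣ)⁻¹, by rw [map_mul, map_inv, ← div_eq_mul_inv]; exact (eq_div_iff_mul_eq'.mpr h).symm⟩⟩
      isOfCharType := ⟨fun u a h => Units.ext (mul_right_cancel (h.trans (one_mul a).symm))⟩ }
  subsingleton_associates := ⟨fun x y => by
    obtain ⟨a, rfl⟩ := Associates.mk_surjective x
    obtain ⟨b, rfl⟩ := Associates.mk_surjective y
    rw [Associates.mk_eq_one.mpr (Group.isUnit a), Associates.mk_eq_one.mpr (Group.isUnit b)]⟩

include H in
/-- The hypotheses of [FrdI] Thm. 5.2 (ii) for the data `(𝒟, Φ, 𝔹, Div_𝔹)` of `𝓕⊛_𝔪𝔬𝔡`, objectwise forms.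
([IUTchIII] Ex 3.6 (ii) p.108) [claim: Mochizuki2012, status: disputed] -/
theorem objectwise_isDivisorial_Φmod :
    Objectwise (fun M _ => IsDivisorial M) (Φmod V Γ nonneg) := fun _ => isDivisorial_effDiv H

/-- `𝔹` is objectwise group-like. ([IUTchIII] Ex 3.6 (ii) p.108) [claim: Mochizuki2012, status: disputed] -/
theorem objectwise_isGroupLike_Bmod : Objectwise (fun M _ => IsGroupLike M) (Bmod F) :=
  fun _ => isGroupLike_units

/-! ### The Frobenioid structure of `𝓕⊛_𝔪𝔬𝔡` -/

/-- "for which the base category is the category with precisely one arrow" (p. 108 l. 8): every object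
lies over the unique object `∗`. ([IUTchIII] Ex 3.6 (ii) p.108) [claim: Mochizuki2012, status: disputed] -/
theorem baseObj_eq (X : FrakCat F V Γ nonneg β) : PreFrobenioid.baseObj (structureFunctor H) X = pt := rfl

/-- … and the one-arrow category has exactly one arrow. ([IUTchIII] Ex 3.6 (ii) p.108) [claim: Mochizuki2012, status: disputed] -/
theorem base_hom_subsingleton (X Y : Base.{u}) (f g : X ⟶ Y) : f = g := Subsingleton.elim f g

/-- "the positive integer '`n`' … is the Frobenius degree of the morphism" (p. 108 l. 10–11).
([IUTchIII] Ex 3.6 (ii) p.108) [claim: Mochizuki2012, status: disputed] -/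
theorem degFr_eq_deg {X Y : FrakCat F V Γ nonneg β} (φ : X ⟶ Y) :
    PreFrobenioid.degFr (structureFunctor H) φ = FrakCat.deg φ := rfl

/-- The zero divisor of `(n, f) : 𝔍₁ → 𝔍₂` is the effective family `f · 𝔍₁^{⊗n} · 𝔍₂^{⊗(-1)}`.
([IUTchIII] Ex 3.6 (ii) p.108) [claim: Mochizuki2012, status: disputed] -/
theorem div_eq_homDiv {X Y : FrakCat F V Γ nonneg β} (φ : X ⟶ Y) :
    PreFrobenioid.Div (structureFunctor H) φ = homDiv H φ := rfl

/-- "the elementary morphisms are precisely the linear morphisms" (p. 108 l. 9–10): `(n, f)` is linear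
([FrdI] Def. 1.2 (i): Frobenius degree `1`) iff `n = 1`, i.e. iff it IS an elementary morphism
`f : 𝔍₁ → 𝔍₂` (abc-iut-L6-t6's `FrakObj.isHom_one_iff`). ([IUTchIII] Ex 3.6 (ii) p.108) [claim: Mochizuki2012, status: disputed] -/
theorem isLinear_iff_deg_eq_one {X Y : FrakCat F V Γ nonneg β} (φ : X ⟶ Y) :
    PreFrobenioid.IsLinear (structureFunctor H) φ ↔ FrakCat.deg φ = 1 := Iff.rfl

/-- A linear morphism's element `f` is an elementary morphism `𝔍₁ → 𝔍₂`; conversely an elementary morphism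
`f` is the linear morphism `(1, f)`. ([IUTchIII] Ex 3.6 (ii) p.108) [claim: Mochizuki2012, status: disputed] -/
theorem isElemHom_of_isLinear {X Y : FrakCat F V Γ nonneg β} (φ : X ⟶ Y)
    (h : PreFrobenioid.IsLinear (structureFunctor H) φ) :
    FrakObj.IsElemHom (nonneg := nonneg) (β := β) X.obj Y.obj (FrakCat.fn φ) := by
  have h' : FrakCat.deg φ = 1 := h
  have hh := FrakCat.Hom.isHom φ
  rw [show FrakCat.Hom.deg φ = 1 from h'] at hh
  exact (FrakObj.isHom_one_iff _ _ _).mp hh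

/-- An elementary morphism `f : 𝔍₁ → 𝔍₂` as the LINEAR morphism `(1, f)` of `𝓕⊛_𝔪𝔬𝔡`.
([IUTchIII] Ex 3.6 (ii) p.108) [claim: Mochizuki2012, status: disputed] -/
theorem isLinear_homMk_one {X Y : FrakCat F V Γ nonneg β} (f : Fˣ)
    (hf : FrakObj.IsElemHom (nonneg := nonneg) (β := β) X.obj Y.obj f) :
    PreFrobenioid.IsLinear (structureFunctor H)
      (FrakCat.homMk 1 f ((FrakObj.isHom_one_iff _ _ _).mpr hf)) := rfl

/-- **`𝓕⊛_𝔪𝔬𝔡` "admits a natural Frobenioid structure [cf. [FrdI], Definition 1.3]"** (p. 108 l. 6–7) —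
VERIFIED: the structure functor satisfies all of [FrdI] Def. 1.3 (i)–(vii) (abc-iut-found's
`PreFrobenioid.IsFrobenioid`), by [FrdI] Thm. 5.2 (ii) for the model Frobenioid of `(𝒟, Φ, 𝔹, Div_𝔹)`
(`Φ` divisorial, `𝔹` group-like, `𝒟` connected and totally epimorphic) transported along the equivalence
`toModel`. ([IUTchIII] Ex 3.6 (ii) p.108) [claim: Mochizuki2012, status: disputed] -/
theorem isFrobenioid : PreFrobenioid.IsFrobenioid (structureFunctor H) :=
  PreFrobenioid.IsFrobenioid.comp_of_isEquivalence (toModel H)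
    (ModelFrobenioid.isFrobenioid (isMonoidOn_constMonoidOn _) (objectwise_isDivisorial_Φmod H)
      (isMonoidOn_constMonoidOn _) objectwise_isGroupLike_Bmod isGraphConnected_base
      isTotallyEpimorphic_base)

/-- The Frobenioid `𝓕⊛_𝔪𝔬𝔡` is of isotropic type ([FrdI] Thm. 5.2 (ii)). ([IUTchIII] Ex 3.6 (ii) p.108) [claim: Mochizuki2012, status: disputed] -/
theorem isOfIsotropicType : PreFrobenioid.IsOfIsotropicType (structureFunctor H) :=
  PreFrobenioid.isOfIsotropicType_comp_equivalence (toModel H).asEquivalence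
    (ModelFrobenioid.isOfIsotropicType objectwise_isGroupLike_Bmod)

/-- In particular `𝓕⊛_𝔪𝔬𝔡 → F_Φ` is a pre-Frobenioid ([FrdI] Def. 1.1 (iv)). ([IUTchIII] Ex 3.6 (ii) p.108) [claim: Mochizuki2012, status: disputed] -/
theorem isPreFrobenioid : IsPreFrobenioid (Φmod V Γ nonneg) (structureFunctor H) :=
  (isFrobenioid H).isPreFrobenioid

end GlobalFrobenioidModels

end Literature.IUT.LogThetaLattice
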